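import Mathlib
import Summits.ValiantsHypothesis.ValiantsHypothesis.Theorems.ValuativeGCTValuativeFlipSeedTableConstraints
import Literature.RepresentationTheory.GeneralLinear.PlethysmWordModelMatIdx

/-!
# Seed richness against the CLASSICAL plethysm table (crux `ValuativeGCT.ValuativeFlip`, stmt-ValiantsHypothesis-12624)

Companion of `ValuativeGCTValuativeFlipSeedTableConstraints.lean` (wall-breaker axis 6/16, "plethysm
tables for `seedRichness`"): the table test of `seed_table_constraints_paddedPer` restated in the
currency of the certified numerical tables, the classical plethysm coefficient
`a_λ(d, m) = plethysmCoeffOfPartition ℂ N m λ` = multiplicity of `S^λ V` in `Symᵈ Symᵐ V`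
(`dim V = N ≥ ℓ(λ)`; Fischer–Ikenmeyer 2020 §2 eq. (2)), through the matrix-space bridge
`Literature.RepresentationTheory.GeneralLinear.plethysmCoeff_partitionWeightLex_eq_plethysmCoeffOfPartition`
(p112323).  Sorry-free.

Certified tables (kit job j018831; `compute/plethysm_tables/main.py`): on Kadish–Landsberg shapes
`max_λ a_λ(d[3]) = 1,1,1,1,2,2,4,7,11,24,64` for `d = 1..11`, so at `n = 3` (threshold
`⌊3⁴/4⌋ + 1 = 21`) a seed weight has degree `d ≥ 10`; `d_min(3,4) = 7`, `d_min(3,5) = d_min(3,6) = 6`,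
`d_min(4,4) = 8` (threshold 65), `d_min(4,5) = 7`, `d_min(4,6) = 6`, `d_min(5,5) = 7` (threshold 157);
`h_d[h_2]` is multiplicity-free, so `(n, m) = (2, 2)` carries no seed datum with `D ≥ 1`.

Sources: BLMW 2011 Prop. 4.4.1, (5.2.2); Kadish–Landsberg 2014; BIP 2019 Thm. 4.9, (4.1); FI 2020 §2.
-/

-- `Summit.ValiantsHypothesis.ValiantsHypothesis.…` repeats a component by the D-0017 layout
-- (single-conjunct summit), which the `dupNamespace` linter flags; the name is mandated.
set_option linter.dupNamespace false

namespace Summit.ValiantsHypothesis.ValiantsHypothesis.Theorems.ValuativeFlip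

open Literature.NumberTheory.DiophantineGeometry Literature.Computability.AlgebraicComplexity

/-- **Table constraints, classical form.**  A seed datum `(ν, D, F)` of the padded permanent at
`n ≤ m` (as in `seed_table_constraints_paddedPer`) forces `ν = partitionWeightLex m λ` for a
partition `λ ⊢ d·m` with `ℓ(λ) ≤ m²`, `ℓ(λ) ≤ n² + 1`, `λ₁ ≥ d (m - n)`, and
`D + 1 ≤ plethysmCoeffOfPartition ℂ N m λ` for EVERY alphabet size `N ≥ ℓ(λ)` — the classical
plethysm coefficient `a_λ(d, m)`, the multiplicity of `S^λ V` in `Symᵈ Symᵐ V` (`dim V = N`), which is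
what the certified tables of this axis list (Fischer–Ikenmeyer 2020 §2 eq. (2); matrix-space bridge
`plethysmCoeff_partitionWeightLex_eq_plethysmCoeffOfPartition`).  Numerically: every admissible
entry is `1` in degrees `d ≤ 4` for `m = 3`, `d ≤ 3` for `m ∈ {4, 5}` and `d ≤ 2` for `m = 6`, so
one-weight richness `D ≥ 1` starts in degree `5`, `4`, `4`, `3` respectively, and richness
`D ≥ n⁴/4` needs `a_λ(d, m) ≥ ⌊n⁴/4⌋ + 1`. [this file] -/
theorem seed_table_constraints_paddedPer_classical {n m : ℕ} [NeZero m] (hnm : n ≤ m)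
    (ν : Weight (MatIdx m)) (D : ℕ)
    (h : ∃ F : Fin (D + 1) → OrbitCoordRing (paddedPerFormLex ℂ n m) m,
      (∀ i, F i ∈ highestWeightSpace (orbitCoordRep (paddedPerFormLex ℂ n m) m) ν) ∧
      AlgebraicIndependent ℂ F) :
    ∃ (d : ℕ) (lam : Nat.Partition (d * m)),
      lam.parts.card ≤ m * m ∧ lam.parts.card ≤ n ^ 2 + 1 ∧ d * (m - n) ≤ lam.parts.sup ∧
      ν = Literature.Computability.Complexity.partitionWeightLex m lam ∧
      ∀ N : ℕ, lam.parts.card ≤ N → D + 1 ≤ plethysmCoeffOfPartition ℂ N m lam := by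
  have h1 : D + 1 ≤ plethysmCoeff ℂ (MatIdx m) m ν := by
    obtain ⟨F, hF, hind⟩ := h
    have h0 := card_le_plethysmCoeff_of_linearIndependent (paddedPerFormLex ℂ n m) (NeZero.ne m)
      (paddedPerFormLex_isHomogeneous (k := ℂ) hnm) ν F hF hind.linearIndependent
    rwa [Fintype.card_fin] at h0
  obtain ⟨d, lam, hmm, hcard, hrow, hν, -⟩ := seed_table_constraints_paddedPer hnm ν D h
  -- re-type `λ ⊢ m·d` as a partition of `d·m` (same parts)
  let lam' : Nat.Partition (d * m) := ⟨lam.parts, lam.parts_pos, by rw [lam.parts_sum, mul_comm]⟩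
  have hw : Literature.Computability.Complexity.partitionWeightLex m lam' =
      (Weight.dualOfPartition (m * m) lam).toMatIdx := rfl
  refine ⟨d, lam', hmm, hcard, hrow, by rw [hw, hν], fun N hN => ?_⟩
  rw [← Literature.RepresentationTheory.GeneralLinear.plethysmCoeff_partitionWeightLex_eq_plethysmCoeffOfPartition
    ℂ m (NeZero.ne m) lam' hmm hN, hw, ← hν]
  exact h1

/-- **The richness threshold against the classical table entry.**  With `n⁴/4 ≤ D` the seed datum
forces `⌊n⁴/4⌋ + 1 ≤ a_λ(d, m) = plethysmCoeffOfPartition ℂ N m λ` at the Kadish–Landsberg shape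
`λ` of its weight, for every `N ≥ ℓ(λ)` — the exact inequality tested against the tables
(`d_min(3,3) = 10`, `d_min(4,4) = 8`, `d_min(5,5) = 7`, …). [this file] -/
theorem seedRichness_threshold_le_plethysmCoeffOfPartition {n m : ℕ} [NeZero m] (hnm : n ≤ m)
    (ν : Weight (MatIdx m)) (D : ℕ) (hD : n ^ 4 / 4 ≤ D)
    (h : ∃ F : Fin (D + 1) → OrbitCoordRing (paddedPerFormLex ℂ n m) m,
      (∀ i, F i ∈ highestWeightSpace (orbitCoordRep (paddedPerFormLex ℂ n m) m) ν) ∧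
      AlgebraicIndependent ℂ F) :
    ∃ (d : ℕ) (lam : Nat.Partition (d * m)),
      lam.parts.card ≤ m * m ∧ lam.parts.card ≤ n ^ 2 + 1 ∧ d * (m - n) ≤ lam.parts.sup ∧
      ν = Literature.Computability.Complexity.partitionWeightLex m lam ∧
      ∀ N : ℕ, lam.parts.card ≤ N → n ^ 4 / 4 + 1 ≤ plethysmCoeffOfPartition ℂ N m lam := by
  obtain ⟨d, lam, hmm, hcard, hrow, hν, hle⟩ := seed_table_constraints_paddedPer_classical hnm ν D h
  exact ⟨d, lam, hmm, hcard, hrow, hν, fun N hN => le_trans (by omega) (hle N hN)⟩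

end Summit.ValiantsHypothesis.ValiantsHypothesis.Theorems.ValuativeFlip
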